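import Summits.KontsevichZagierPeriods.KontsevichZagierPeriods.Theorems.SoloInformedSectorFan
import Summits.KontsevichZagierPeriods.KontsevichZagierPeriods.Theorems.SoloInformedToricBoxSplit
import HarnessLib

/-!
# The corner cell is covered by a fan, a swapped fan and grid cells off the corner

Solo programme `solo-KontsevichZagierPeriods-informed`, session s111, step (γ-8b) of the kernel
project PRES-RAT(2) (the corner step of the vertex recursion).

For `Ω ⊆ (0,1)²`, `κ = 1/N` and an integer `M ≥ 1`, the corner cell `Ω ∩ [0, κ]²` is, up to
null lines, the disjoint union of

* `Ω ∩ Fan(κ/M, M)` (slopes `< M`, abscissa `< κ/M`) — covered by sectors of the germ,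
* `Ω ∩ swap⁻¹ Fan(κ, 1/M)` (slopes `> M`) — covered by sectors of the swapped germ,
* the cells `Ω ∩ Z` of the grid `N M` inside `[κ/M, κ] × [0, κ]` — which avoid the corner.

Hence (rule (1)) presentability on these pieces gives presentability on the corner cell.  The
integer `M` lets the first family reach every finite tangent slope of the germ, so that the
swapped family only ever meets the vertical tangent.

References: Kontsevich–Zagier, *Periods* (2001), §1.2 rule (1).
-/

noncomputable section

open scoped BigOperators
open MeasureTheory Set
open Literature.NumberTheory.Transcendental Literature.NumberTheory.Transcendental.KZ
open Literature.ModelTheory.ExponentialFields (IsSemialgebraic)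

namespace Summit.KontsevichZagierPeriods.KontsevichZagierPeriods.Theorems

variable {K : Type*} [Field K] [Algebra K ℝ]

/-- The fan with parameters `1/L, B` (`L ∈ ℕ`, `B ∈ K`) is `ℚ`-semialgebraic. -/
theorem soloInformed_isSemialgebraic_fan_inv (hK : ∀ c : K, IsAlgebraic ℚ (algebraMap K ℝ c))
    (L : ℕ) (B : K) :
    IsSemialgebraic ℚ (soloInformedFan ((L : ℝ)⁻¹) (algebraMap K ℝ B)) := by
  have h := soloInformed_isSemialgebraic_fan hK ((L : K)⁻¹) B
  rwa [map_inv₀, map_natCast] at h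

/-- **The corner-cell cover.**  Let `Ω ⊆ (0,1)²` be `ℚ`-semialgebraic, `N, M ≥ 1`.  If `f` is
presentable on `Ω ∩ Fan(1/(N M), M)`, on `Ω ∩ swap⁻¹ Fan(1/N, 1/M)` and on every cell `Ω ∩ Z` of
the grid `N M` with index `1 ≤ j₀ < M`, `j₁ < M`, then `f` is presentable on the corner cell
`Ω ∩ [0, 1/N]²`. [this work] -/
theorem soloInformed_presOn_inter_cornerCell (hK : ∀ c : K, IsAlgebraic ℚ (algebraMap K ℝ c))
    {Ω : Set (Fin 2 → ℝ)} (hΩ : IsSemialgebraic ℚ Ω) (hΩc : Ω ⊆ soloInformedOpenCube 2)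
    {f : (Fin 2 → ℝ) → ℝ} {N M : ℕ} (hN : 0 < N) (hM : 0 < M)
    (hfan : SoloInformedPresOn (Ω ∩ soloInformedFan (((N * M : ℕ) : ℝ)⁻¹)
      (algebraMap K ℝ (M : K))) f)
    (hswap : SoloInformedPresOn (Ω ∩ (fun z : Fin 2 → ℝ => (![z 1, z 0] : Fin 2 → ℝ)) ⁻¹'
      soloInformedFan ((N : ℝ)⁻¹) (algebraMap K ℝ ((M : K)⁻¹))) f)
    (hcell : ∀ j : Fin 2 → Fin (N * M), 1 ≤ (j 0 : ℕ) → (j 0 : ℕ) < M → (j 1 : ℕ) < M →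
      SoloInformedPresOn (Ω ∩ soloInformedGridCell (N * M) j) f)
    {j : Fin 2 → Fin N} (hj : ∀ i, (j i : ℕ) = 0) :
    SoloInformedPresOn (Ω ∩ soloInformedGridCell N j) f := by
  classical
  -- the parameters
  have hNr : (0 : ℝ) < N := by exact_mod_cast hN
  have hMr : (0 : ℝ) < M := by exact_mod_cast hM
  have hM1 : (1 : ℝ) ≤ M := by exact_mod_cast hM
  have hNM : 0 < N * M := Nat.mul_pos hN hM
  have hNMr : (0 : ℝ) < ((N * M : ℕ) : ℝ) := by exact_mod_cast hNM
  set κ : ℝ := (N : ℝ)⁻¹ with hκ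
  set κ₁ : ℝ := (((N * M : ℕ) : ℝ))⁻¹ with hκ₁
  have hκpos : 0 < κ := inv_pos.2 hNr
  have hκ₁pos : 0 < κ₁ := inv_pos.2 hNMr
  have hκ₁M : κ₁ * M = κ := by
    rw [hκ₁, hκ, Nat.cast_mul]; field_simp
  have hκ₁le : κ₁ ≤ κ := by
    rw [← hκ₁M]; exact le_mul_of_one_le_right hκ₁pos.le hM1
  have hMB : algebraMap K ℝ (M : K) = M := map_natCast _ _
  have hMB' : algebraMap K ℝ ((M : K)⁻¹) = (M : ℝ)⁻¹ := by rw [map_inv₀, map_natCast]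
  rw [hMB] at hfan
  rw [hMB'] at hswap
  -- membership in the corner cell
  have hmemT : ∀ z : Fin 2 → ℝ, z ∈ soloInformedGridCell N j ↔ ∀ i, 0 ≤ z i ∧ z i ≤ κ := by
    intro z
    rw [soloInformed_mem_gridCell_iff]
    refine forall_congr' fun i => ?_
    rw [hj i, Nat.cast_zero, zero_div, zero_add, one_div]
  -- the three pieces
  set A := Ω ∩ soloInformedFan κ₁ M with hA
  set B := Ω ∩ (fun z : Fin 2 → ℝ => (![z 1, z 0] : Fin 2 → ℝ)) ⁻¹' soloInformedFan κ (M : ℝ)⁻¹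
    with hB
  set ι := {j' : Fin 2 → Fin (N * M) // 1 ≤ (j' 0 : ℕ) ∧ (j' 0 : ℕ) < M ∧ (j' 1 : ℕ) < M} with hι
  set S : ι → Set (Fin 2 → ℝ) := fun j' => Ω ∩ soloInformedGridCell (N * M) j'.1 with hS
  set C := ⋃ j', S j' with hC
  have hAsa : IsSemialgebraic ℚ A := hΩ.inter (soloInformed_isSemialgebraic_fan_inv hK (N * M) _ |>
    fun h => by rwa [hMB] at h)
  have hBsa : IsSemialgebraic ℚ B :=
    hΩ.inter (soloInformed_isSemialgebraic_swap_preimage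
      (soloInformed_isSemialgebraic_fan_inv hK N ((M : K)⁻¹) |> fun h => by rwa [hMB'] at h))
  have hSsa : ∀ j', IsSemialgebraic ℚ (S j') := fun j' =>
    hΩ.inter (isSemialgebraic_soloInformedGridCell _ _)
  have hCsa : IsSemialgebraic ℚ C := by
    have : C = ⋃ j' ∈ (Finset.univ : Finset ι), S j' := by
      rw [hC]; simp only [Finset.mem_univ, iUnion_true]
    rw [this]
    exact IsSemialgebraic.biUnion _ _ fun j' _ => hSsa j'
  -- membership descriptions
  have hmemA : ∀ z, z ∈ A ↔ z ∈ Ω ∧ 0 < z 0 ∧ z 0 < κ₁ ∧ 0 < z 1 ∧ z 1 < M * z 0 := fun z => by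
    rw [hA]; rfl
  have hmemB : ∀ z, z ∈ B ↔ z ∈ Ω ∧ 0 < z 1 ∧ z 1 < κ ∧ 0 < z 0 ∧ z 0 < (M : ℝ)⁻¹ * z 1 :=
    fun z => by
    rw [hB]
    simp only [mem_inter_iff, mem_preimage, soloInformedFan, mem_setOf_eq, Matrix.cons_val_zero,
      Matrix.cons_val_one]
  have hA0 : ∀ z ∈ A, z 0 < κ₁ := fun z hz => ((hmemA z).1 hz).2.2.1
  have hB0 : ∀ z ∈ B, z 0 < κ₁ := fun z hz => by
    obtain ⟨-, -, h1, -, h0⟩ := (hmemB z).1 hz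
    calc z 0 < (M : ℝ)⁻¹ * z 1 := h0
      _ ≤ (M : ℝ)⁻¹ * κ := mul_le_mul_of_nonneg_left h1.le (inv_nonneg.2 hMr.le)
      _ = κ₁ := by rw [← hκ₁M]; field_simp
  have hC0 : ∀ z ∈ C, κ₁ ≤ z 0 := fun z hz => by
    obtain ⟨j', hz⟩ := mem_iUnion.1 hz
    have h := ((soloInformed_mem_gridCell_iff.1 hz.2) 0).1
    refine le_trans ?_ h
    rw [hκ₁, inv_eq_one_div]
    exact div_le_div_of_nonneg_right (by exact_mod_cast j'.2.1) hNMr.le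
  -- `A ∪ B`
  have hAB : SoloInformedPresOn (A ∪ B) f := by
    refine soloInformed_presOn_union hAsa hBsa ?_ rfl hfan hswap
    have : A ∩ B = ∅ := eq_empty_iff_forall_notMem.2 fun z ⟨hzA, hzB⟩ => by
      obtain ⟨-, h0, -, -, hA1⟩ := (hmemA z).1 hzA
      obtain ⟨-, h1, -, -, hB1⟩ := (hmemB z).1 hzB
      have : z 1 < z 1 := by
        calc z 1 < M * z 0 := hA1
          _ < M * ((M : ℝ)⁻¹ * z 1) := mul_lt_mul_of_pos_left hB1 hMr
          _ = z 1 := by field_simp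
      exact lt_irrefl _ this
    rw [this, measure_empty]
  -- `C`
  have hCpres : SoloInformedPresOn C f := by
    refine soloInformed_presOn_of_iUnion S hSsa (fun a b hab => ?_) rfl fun j' =>
      hcell j'.1 j'.2.1 j'.2.2.1 j'.2.2.2
    have hne : a.1 ≠ b.1 := fun h => hab (Subtype.ext h)
    exact measure_mono_null (fun z (hz : z ∈ S a ∩ S b) => show z ∈ soloInformedGridCell (N * M)
      a.1 ∩ soloInformedGridCell (N * M) b.1 from ⟨hz.1.2, hz.2.2⟩)
      (soloInformed_volume_gridCell_inter hne)
  -- `A ∪ B ∪ C`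
  have hABC : SoloInformedPresOn (A ∪ B ∪ C) f := by
    refine soloInformed_presOn_union (hAsa.union hBsa) hCsa ?_ rfl hAB hCpres
    have : (A ∪ B) ∩ C = ∅ := eq_empty_iff_forall_notMem.2 fun z ⟨hzAB, hzC⟩ => by
      have h0 : z 0 < κ₁ := hzAB.elim (hA0 z) (hB0 z)
      exact absurd (hC0 z hzC) (not_le.2 h0)
    rw [this, measure_empty]
  -- the pieces lie in the corner cell
  have hsub : A ∪ B ∪ C ⊆ Ω ∩ soloInformedGridCell N j := by
    rintro z ((hzA | hzB) | hzC)
    · obtain ⟨hzΩ, h0, h0', h1, h1'⟩ := (hmemA z).1 hzA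
      refine ⟨hzΩ, (hmemT z).2 fun i => ?_⟩
      have e1 : z 1 ≤ κ := by
        have : M * z 0 ≤ M * κ₁ := mul_le_mul_of_nonneg_left h0'.le hMr.le
        rw [mul_comm (M : ℝ) κ₁, hκ₁M] at this
        linarith
      fin_cases i
      exacts [⟨h0.le, h0'.le.trans hκ₁le⟩, ⟨h1.le, e1⟩]
    · obtain ⟨hzΩ, h1, h1', h0, h0'⟩ := (hmemB z).1 hzB
      refine ⟨hzΩ, (hmemT z).2 fun i => ?_⟩
      have e0 : z 0 ≤ κ := (hB0 z hzB).le.trans hκ₁le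
      fin_cases i
      exacts [⟨h0.le, e0⟩, ⟨h1.le, h1'.le⟩]
    · obtain ⟨j', hzΩ, hz⟩ := mem_iUnion.1 hzC
      refine ⟨hzΩ, (hmemT z).2 fun i => ?_⟩
      have hzi := (soloInformed_mem_gridCell_iff.1 hz) i
      refine ⟨le_trans (div_nonneg (Nat.cast_nonneg _) hNMr.le) hzi.1, hzi.2.trans ?_⟩
      have hji : ((j'.1 i : ℕ) : ℝ) + 1 ≤ M := by
        have : (j'.1 i : ℕ) < M := by
          fin_cases i
          exacts [j'.2.2.1, j'.2.2.2]
        exact_mod_cast Nat.succ_le_of_lt this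
      calc (((j'.1 i : ℕ) : ℝ) + 1) / ((N * M : ℕ) : ℝ) ≤ M / ((N * M : ℕ) : ℝ) :=
            div_le_div_of_nonneg_right hji hNMr.le
        _ = κ := by rw [← hκ₁M, hκ₁]; field_simp
  -- and exhaust it up to null lines
  have hdiff : (Ω ∩ soloInformedGridCell N j) \ (A ∪ B ∪ C) ⊆
      {z : Fin 2 → ℝ | z 1 = M * z 0} ∪ {z | z 1 = κ} ∪ ({z | z 0 = κ₁} ∪ {z | z 0 = κ}) := by
    rintro z ⟨⟨hzΩ, hzT⟩, hzU⟩
    have hT := (hmemT z).1 hzT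
    have hop := hΩc hzΩ
    have hz0 : 0 < z 0 := (hop 0).1
    have hz1 : 0 < z 1 := (hop 1).1
    by_contra hnot
    simp only [mem_union, mem_setOf_eq, not_or] at hnot
    obtain ⟨⟨hray, h1κ⟩, h0κ₁, h0κ⟩ := hnot
    have hz1κ : z 1 < κ := lt_of_le_of_ne (hT 1).2 h1κ
    rcases lt_or_ge (z 0) κ₁ with h0 | h0
    · rcases lt_trichotomy (z 1) (M * z 0) with h | h | h
      · exact hzU (Or.inl (Or.inl ((hmemA z).2 ⟨hzΩ, hz0, h0, hz1, h⟩)))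
      · exact hray h
      · refine hzU (Or.inl (Or.inr ((hmemB z).2 ⟨hzΩ, hz1, hz1κ, hz0, ?_⟩)))
        rw [lt_inv_mul_iff₀ hMr]
        exact h
    · -- `z` lies in a cell of the grid `N M` off the corner
      have hzcube : z ∈ soloInformedCube 2 :=
        soloInformedGridCell_subset_cube j hzT
      obtain ⟨j', hz⟩ := soloInformed_exists_mem_gridCell hNM hzcube
      have hm := soloInformed_mem_gridCell_iff.1 hz
      have hj0 : 1 ≤ (j' 0 : ℕ) := by
        by_contra hlt
        have hj00 : (j' 0 : ℕ) = 0 := by omega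
        have := (hm 0).2
        rw [hj00, Nat.cast_zero, zero_add, one_div] at this
        exact h0κ₁ (le_antisymm this h0)
      have hup : ∀ i, z i < κ → (j' i : ℕ) < M := fun i hi => by
        by_contra hge
        have hge' : (M : ℝ) ≤ ((j' i : ℕ) : ℝ) := by exact_mod_cast not_lt.1 hge
        have := (hm i).1
        have hle : κ ≤ ((j' i : ℕ) : ℝ) / ((N * M : ℕ) : ℝ) := by
          calc κ = (M : ℝ) / ((N * M : ℕ) : ℝ) := by rw [← hκ₁M, hκ₁]; field_simp
            _ ≤ _ := div_le_div_of_nonneg_right hge' hNMr.le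
        linarith
      have hz0κ : z 0 < κ := lt_of_le_of_ne (hT 0).2 h0κ
      exact hzU (Or.inr (mem_iUnion.2 ⟨⟨j', hj0, hup 0 hz0κ, hup 1 hz1κ⟩, hzΩ, hz⟩))
  have hvol : volume ((Ω ∩ soloInformedGridCell N j) \ (A ∪ B ∪ C)) = 0 :=
    measure_mono_null hdiff (measure_union_null (measure_union_null (soloInformed_volume_ray _)
      (soloInformed_volume_hyperplane 1 κ)) (measure_union_null
      (soloInformed_volume_hyperplane 0 κ₁) (soloInformed_volume_hyperplane 0 κ)))
  exact soloInformed_presOn_of_subset_null ((hAsa.union hBsa).union hCsa) hsub hvol hABC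

end Summit.KontsevichZagierPeriods.KontsevichZagierPeriods.Theorems
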